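import Summits.NavierStokesRegularity.NavierStokesRegularity.Theorems.LerayQuarterDissipationFiniteDissipationLiouvilleEnergyTraceDatum
import Summits.NavierStokesRegularity.NavierStokesRegularity.Theorems.LerayQuarterDissipationFiniteDissipationLiouvilleTraceRecurrent
import HarnessLib

/-!
# Crux `FiniteDissipationLiouville` (stmt-NavierStokesRegularity-22144): NO EARLY ARRIVAL — a
# finite-dissipation Type-I profile is never energy-close to its own final datum before the
# singular time; the remainder energy obeys the TWO-SIDED law `δ² √(−t) < ‖W(t) − u₀‖²_{L²} ≤ M √(−t)`

Theorems file of route `LerayQuarterDissipation` (lead prover ns-lqd-lead g9; `--supports` the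
crux, line `birth`; the lower companion of `…EnergyRemainder`). Navier–Stokes regularity is NOT
proved by anything here; no summit is.

`𝒟_{C,K}`: Type-I ancient mild fields `w` (KNSS gauge) with the quarter-rate law; `T_w(ψ)` the
distributional trace at the apex (`lim_{t→0⁻} ∫⟪w(t), ψ⟫`, lead g3). Lead g9
(`…EnergyRemainder`) proved that the singular part `W(t) − u₀` of the critical element has
energy `≤ M √(−t)`. Here the FLOOR, by compactness:

* `false_of_earlyArrival_seq` — compactness core: no sequence of singular members of `𝒟_{C,K}`
  whose slices at `t = −1` are asymptotically equal to their own final data in the dual-`L²`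
  sense (`|T_k(ψ) − ∫⟪w_k(−1), ψ⟫| ≤ ‖ψ‖_{L²}/(k+1)`): the KNSS limit is a singular member whose
  trace IS its (bounded, continuous) slice at `−1` (continuity of the trace along the limit,
  `tendsto_trace_of_tendsto_slices`, lead g3; dominated convergence of the slice pairings),
  hence locally bounded at the apex — `not_singular_of_trace_locallyBounded` (lead g5) makes it
  regular, contradicting persistence.
* `earlyArrival_leaf` — **ONE-SLICE NO-EARLY-ARRIVAL LEAF**: `∀ C K, ∃ δ > 0`: if at ONE instant
  `t < 0` the slice is `δ`-close to the final datum, `|T_w(ψ) − ∫⟪w(t), ψ⟫| ≤ δ (−t)^{1/4} ‖ψ‖_{L²}`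
  for every test field, then `w` is regular (dilation invariance `pairing_sub_trace_nsRescale`).
* `remainder_floor_of_singular` — contrapositive, **portrait clause: for every singular member
  and EVERY `t < 0` some test field has `|T_w(ψ) − ∫⟪w(t), ψ⟫| > δ (−t)^{1/4} ‖ψ‖_{L²}`**; for the
  critical element, whose trace is the function `u₀` with `W(t) − u₀ ∈ L²`
  (`…EnergyTraceDatum`, `…EnergyRemainder`), `remainderEnergy_floor_of_minimal`:
  **`δ² √(−t) < ∫ ‖W(t) − u₀‖² ≤ M √(−t)` — the energy of the singular part is `≍ √(−t)` from
  both sides.** The profile cannot "arrive early" at its final state at any scale: a genuinely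
  dynamical exclusion (no quasi-stationary approach to the blow-up profile in energy).

HONEST FRAMING: `δ(C,K)` by compactness; a discretely self-similar profile has a `λ`-DSS
remainder with `‖W(λ²t) − u₀‖² = λ ‖W(t) − u₀‖²`, consistent with the law; nothing removed.
No summit is proved.

References: Koch–Nadirashvili–Seregin–Šverák, Acta Math. 203 (2009) = arXiv:0709.3599, §4;
Lemarié-Rieusset 2016, Ch. 14–15 (traces of local Leray solutions).
-/

noncomputable section

-- the summit and its single sub-problem share the name (CONVENTIONS §1), as in every Theorems file
set_option linter.dupNamespace false

namespace Summit.NavierStokesRegularity.NavierStokesRegularity.Theorems.FiniteDissipationLiouville.EnergyReturn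

open MeasureTheory Set Filter Topology Metric Function TopologicalSpace
open Literature.Analysis Literature.Analysis.FluidPDE
open Summit.NavierStokesRegularity.NavierStokesRegularity.Theorems.FiniteDissipationLiouville
open Summit.NavierStokesRegularity.NavierStokesRegularity.Theorems.FiniteDissipationLiouville.Birth.Apex
open Summit.NavierStokesRegularity.NavierStokesRegularity.Theorems
open scoped ENNReal NNReal RealInnerProductSpace

variable {C K : ℝ} {u : ℝ → EuclideanSpace ℝ (Fin 3) → EuclideanSpace ℝ (Fin 3)}

/-! ### Dilation invariance of the hypothesis -/

/-- **The dual-`L²` distance between a slice and the trace is dilation invariant** in the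
normalisation `(−t)^{1/4} ‖ψ‖_{L²}`: if `|T_u(φ) − ∫⟪u(t), φ⟫| ≤ δ (−t)^{1/4} ‖φ‖_{L²}` for all test
fields `φ` at the instant `t < 0`, then the dilate `u_c`, `c = √(−t)`, satisfies
`|T_{u_c}(ψ) − ∫⟪u_c(−1), ψ⟫| ≤ δ ‖ψ‖_{L²}` for all test fields `ψ`. -/
theorem pairing_sub_trace_nsRescale (hu : IsTypeIAncientMild C u)
    (hlaw : ∀ s : ℝ, s < 0 → ∫⁻ x, ‖fderiv ℝ (u s) x‖ₑ ^ 2 ≤ ENNReal.ofReal (K / Real.sqrt (-s)))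
    {t δ : ℝ} (ht : t < 0)
    (hclose : ∀ φ : EuclideanSpace ℝ (Fin 3) → EuclideanSpace ℝ (Fin 3),
      FunctionSpaces.IsTestFunctionOn (⊤ : Opens (EuclideanSpace ℝ (Fin 3))) φ →
      ∀ T : ℝ, Tendsto (fun s => ∫ x, ⟪u s x, φ x⟫) (𝓝[<] 0) (𝓝 T) →
        |T - ∫ x, ⟪u t x, φ x⟫| ≤ δ * (-t) ^ (1 / 4 : ℝ) * Real.sqrt (∫ x, ‖φ x‖ ^ 2)) :
    ∀ ψ : EuclideanSpace ℝ (Fin 3) → EuclideanSpace ℝ (Fin 3),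
      FunctionSpaces.IsTestFunctionOn (⊤ : Opens (EuclideanSpace ℝ (Fin 3))) ψ →
      ∀ T : ℝ, Tendsto (fun s => ∫ x, ⟪nsRescale (Real.sqrt (-t)) u s x, ψ x⟫) (𝓝[<] 0) (𝓝 T) →
        |T - ∫ x, ⟪nsRescale (Real.sqrt (-t)) u (-1) x, ψ x⟫| ≤ δ * Real.sqrt (∫ x, ‖ψ x‖ ^ 2) := by
  intro ψ hψ T hT
  set c : ℝ := Real.sqrt (-t) with hc_def
  have hc : 0 < c := Real.sqrt_pos.2 (neg_pos.2 ht)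
  have hc2 : c ^ 2 = -t := Real.sq_sqrt (neg_nonneg.2 ht.le)
  -- the trace of `u` against the dilated field, and `T = c⁻² T'`
  obtain ⟨T', hT'⟩ := exists_tendsto_pairing_finalSlice hu hlaw
    (hψ.comp_smul_top (inv_ne_zero hc.ne'))
  have hTv := tendsto_pairing_nsRescale (w := u) hc hT'
  have hTeq : T = (c ^ 2)⁻¹ * T' := tendsto_nhds_unique hT hTv
  -- the slice pairing of the dilate
  have hslice : ∫ x, ⟪nsRescale c u (-1) x, ψ x⟫ = (c ^ 2)⁻¹ * ∫ y, ⟪u t y, ψ (c⁻¹ • y)⟫ := by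
    rw [integral_pairing_nsRescale hc ψ (-1), show c ^ 2 * (-1 : ℝ) = t by rw [hc2]; ring]
  have h := hclose _ (hψ.comp_smul_top (inv_ne_zero hc.ne')) T' hT'
  rw [integral_comp_inv_smul_eq (g := fun x => ‖ψ x‖ ^ 2) hc,
    EnergyTrace.sqrt_cube_mul hc.le] at h
  -- `(−t)^{1/4} = √c`
  have hquart : (-t) ^ (1 / 4 : ℝ) = Real.sqrt c := by
    rw [← hc2, Real.sqrt_eq_rpow, ← Real.rpow_natCast c 2, ← Real.rpow_mul hc.le]
    norm_num
  rw [hquart] at h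
  have hss : Real.sqrt c * Real.sqrt c = c := Real.mul_self_sqrt hc.le
  have hcc : 0 < c ^ 2 := by positivity
  rw [hTeq, hslice, ← mul_sub, abs_mul, abs_of_pos (inv_pos.2 hcc)]
  set I : ℝ := Real.sqrt (∫ x, ‖ψ x‖ ^ 2) with hI
  calc (c ^ 2)⁻¹ * |T' - ∫ y, ⟪u t y, ψ (c⁻¹ • y)⟫|
      ≤ (c ^ 2)⁻¹ * (δ * Real.sqrt c * (c * Real.sqrt c * I)) :=
        mul_le_mul_of_nonneg_left h (inv_nonneg.2 hcc.le)
    _ = (c ^ 2)⁻¹ * (δ * c * (Real.sqrt c * Real.sqrt c) * I) := by ring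
    _ = δ * I := by rw [hss]; field_simp

/-! ### The compactness core -/

/-- **No sequence of singular members of `𝒟_{C,K}` arrives asymptotically early at its final
data**: if `|T_k(ψ) − ∫⟪w_k(−1), ψ⟫| ≤ ‖ψ‖_{L²}/(k+1)` for every test field `ψ` and every trace value
`T_k(ψ)` of `w_k`, the KNSS limit is a singular member whose trace is its bounded slice at `−1`,
hence regular — contradiction. [cite: KochNadirashviliSereginSverak2009, §4 (arXiv:0709.3599 p. 8)] -/
theorem false_of_earlyArrival_seq
    {w : ℕ → ℝ → EuclideanSpace ℝ (Fin 3) → EuclideanSpace ℝ (Fin 3)}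
    (hwk : ∀ k, IsTypeIAncientMild C (w k))
    (hlaw : ∀ k, ∀ s : ℝ, s < 0 →
      ∫⁻ x, ‖fderiv ℝ (w k s) x‖ₑ ^ 2 ≤ ENNReal.ofReal (K / Real.sqrt (-s)))
    (hsing : ∀ k, ∀ ρ > 0, ∀ M : ℝ, ∃ t ∈ Ioo (-(ρ ^ 2)) (0 : ℝ),
      ∃ x ∈ ball (0 : EuclideanSpace ℝ (Fin 3)) ρ, M < ‖w k t x‖)
    (hclose : ∀ k, ∀ ψ : EuclideanSpace ℝ (Fin 3) → EuclideanSpace ℝ (Fin 3),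
      FunctionSpaces.IsTestFunctionOn (⊤ : Opens (EuclideanSpace ℝ (Fin 3))) ψ →
      ∀ T : ℝ, Tendsto (fun s => ∫ x, ⟪w k s x, ψ x⟫) (𝓝[<] 0) (𝓝 T) →
        |T - ∫ x, ⟪w k (-1) x, ψ x⟫| ≤ 1 / ((k : ℝ) + 1) * Real.sqrt (∫ x, ‖ψ x‖ ^ 2)) :
    False := by
  obtain ⟨φs, hφs, W, hW, hunif, hpt, hgrad⟩ := Compactness.seqLimit hwk
  have hφt : Tendsto φs atTop atTop := hφs.tendsto_atTop
  have hWlaw : ∀ s : ℝ, s < 0 →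
      ∫⁻ x, ‖fderiv ℝ (W s) x‖ₑ ^ 2 ≤ ENNReal.ofReal (K / Real.sqrt (-s)) :=
    Compactness.law_of_seqLimit (Kinf := K) (Kk := fun _ => K) hφt hlaw
      (fun ε hε => Eventually.of_forall fun _ => by linarith) hgrad
  have hWsing := Compactness.persistent_singularity_seq (w := fun j => w (φs j))
    (fun j => hwk (φs j)) (fun j => hlaw (φs j)) (fun j => hsing (φs j)) hW hunif
  have h1 : (-1 : ℝ) < 0 := by norm_num
  have hC : 0 ≤ C := hW.nonneg
  -- ### the trace of `W` is its slice at `−1`, a bounded continuous field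
  refine not_singular_of_trace_locallyBounded hW hWlaw one_pos (M := C) (fun ψ hψ _ L hL => ?_) hWsing
  have hcψ : Continuous ψ := hψ.contDiff.continuous
  have hψcs : HasCompactSupport ψ := hψ.hasCompactSupport
  -- trace values of the approximants and their convergence to `L`
  have hex : ∀ j, ∃ Tj : ℝ, Tendsto (fun s => ∫ x, ⟪w (φs j) s x, ψ x⟫) (𝓝[<] 0) (𝓝 Tj) :=
    fun j => exists_tendsto_pairing_finalSlice (hwk (φs j)) (hlaw (φs j)) hψ
  choose Tj hTj using hex
  have hconvT : Tendsto Tj atTop (𝓝 L) :=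
    tendsto_trace_of_tendsto_slices hψ (fun j => hwk (φs j)) (fun j => hlaw (φs j)) hW hWlaw
      (fun t ht x => hpt t ht x) hTj hL
  -- the slice pairings at `−1` converge to that of `W` (dominated convergence, bound `C ‖ψ‖`)
  have hconvS : Tendsto (fun j => ∫ x, ⟪w (φs j) (-1) x, ψ x⟫) atTop (𝓝 (∫ x, ⟪W (-1) x, ψ x⟫)) := by
    refine tendsto_integral_of_dominated_convergence (fun x => C * ‖ψ x‖)
      (fun j => ((hwk (φs j)).continuous_slice h1).aestronglyMeasurable.inner hcψ.aestronglyMeasurable)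
      ((hcψ.norm.integrable_of_hasCompactSupport hψcs.norm).const_mul C) (fun j => ?_) ?_
    · refine Eventually.of_forall fun x => ?_
      rw [Real.norm_eq_abs]
      refine (abs_real_inner_le_norm _ _).trans (mul_le_mul_of_nonneg_right ?_ (norm_nonneg _))
      have h := (hwk (φs j)).norm_le h1 x
      rwa [neg_neg, Real.sqrt_one, div_one] at h
    · exact Eventually.of_forall fun x =>
        ((hpt (-1) h1 x).inner tendsto_const_nhds)
  -- the hypothesis: `Tj − ∫⟪w_{φ j}(−1), ψ⟫ → 0`
  set I : ℝ := Real.sqrt (∫ x, ‖ψ x‖ ^ 2) with hI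
  have hdiff : Tendsto (fun j => Tj j - ∫ x, ⟪w (φs j) (-1) x, ψ x⟫) atTop (𝓝 0) := by
    have hmaj : Tendsto (fun j => 1 / ((φs j : ℝ) + 1) * I) atTop (𝓝 0) := by
      have h1 : Tendsto (fun j => 1 / ((φs j : ℝ) + 1)) atTop (𝓝 0) := by
        have h2 : Tendsto (fun j => (φs j : ℝ) + 1) atTop atTop :=
          tendsto_atTop_add_const_right _ _ (tendsto_natCast_atTop_atTop.comp hφt)
        exact tendsto_const_nhds.div_atTop h2
      simpa using h1.mul_const I
    exact squeeze_zero_norm (fun j => by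
      rw [Real.norm_eq_abs]; exact hclose (φs j) ψ hψ (Tj j) (hTj j)) hmaj
  have hLeq : L = ∫ x, ⟪W (-1) x, ψ x⟫ := by
    have h3 : Tendsto (fun j => (∫ x, ⟪w (φs j) (-1) x, ψ x⟫) +
        (Tj j - ∫ x, ⟪w (φs j) (-1) x, ψ x⟫)) atTop (𝓝 ((∫ x, ⟪W (-1) x, ψ x⟫) + 0)) :=
      hconvS.add hdiff
    rw [add_zero] at h3
    exact tendsto_nhds_unique hconvT (h3.congr fun j => by ring)
  -- the bound `|L| ≤ C ∫‖ψ‖`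
  rw [hLeq]
  have hint : Integrable (fun x => ⟪W (-1) x, ψ x⟫) :=
    integrable_inner_of_continuous_of_hasCompactSupport (hW.continuous_slice h1) hcψ hψcs
  have hint2 : Integrable (fun x => C * ‖ψ x‖) :=
    (hcψ.norm.integrable_of_hasCompactSupport hψcs.norm).const_mul C
  rw [← Real.norm_eq_abs, ← integral_const_mul]
  refine (norm_integral_le_integral_norm _).trans (integral_mono hint.norm hint2 fun x => ?_)
  refine (norm_inner_le_norm _ _).trans (mul_le_mul_of_nonneg_right ?_ (norm_nonneg _))
  have h := hW.norm_le h1 x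
  rwa [neg_neg, Real.sqrt_one, div_one] at h

/-! ### The one-slice leaf and the floor -/

/-- **ONE-SLICE NO-EARLY-ARRIVAL LEAF.** For all `C, K` there is `δ = δ(C,K) > 0` such that a member
of `𝒟_{C,K}` whose slice at ONE instant `t < 0` is `δ`-close to its final datum in the dual-`L²`
sense — `|T_w(ψ) − ∫⟪w(t), ψ⟫| ≤ δ (−t)^{1/4} ‖ψ‖_{L²}` for every test field `ψ` and trace value
`T_w(ψ)` — is bounded on some backward cylinder at the origin. [cite: KochNadirashviliSereginSverak2009, §4 (arXiv:0709.3599 p. 8)] -/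
theorem earlyArrival_leaf : ∀ (C K : ℝ), ∃ δ > 0,
    ∀ (w : ℝ → EuclideanSpace ℝ (Fin 3) → EuclideanSpace ℝ (Fin 3)),
      IsTypeIAncientMild C w →
      (∀ s : ℝ, s < 0 → ∫⁻ x, ‖fderiv ℝ (w s) x‖ₑ ^ 2 ≤ ENNReal.ofReal (K / Real.sqrt (-s))) →
      (∃ t < 0, ∀ ψ : EuclideanSpace ℝ (Fin 3) → EuclideanSpace ℝ (Fin 3),
        FunctionSpaces.IsTestFunctionOn (⊤ : Opens (EuclideanSpace ℝ (Fin 3))) ψ →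
        ∀ T : ℝ, Tendsto (fun s => ∫ x, ⟪w s x, ψ x⟫) (𝓝[<] 0) (𝓝 T) →
          |T - ∫ x, ⟪w t x, ψ x⟫| ≤ δ * (-t) ^ (1 / 4 : ℝ) * Real.sqrt (∫ x, ‖ψ x‖ ^ 2)) →
      ¬ (∀ ρ > 0, ∀ M : ℝ, ∃ t ∈ Ioo (-(ρ ^ 2)) (0 : ℝ),
        ∃ x ∈ ball (0 : EuclideanSpace ℝ (Fin 3)) ρ, M < ‖w t x‖) := by
  intro C K
  by_contra hcon
  push Not at hcon
  choose w' hw' hlaw' hq' hsing' using hcon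
  choose t' ht' hq' using hq'
  have hpos : ∀ k : ℕ, (0 : ℝ) < 1 / ((k : ℝ) + 1) := fun k => by positivity
  set w : ℕ → ℝ → EuclideanSpace ℝ (Fin 3) → EuclideanSpace ℝ (Fin 3) :=
    fun k => w' _ (hpos k) with hw_def
  have hw : ∀ k, IsTypeIAncientMild C (w k) := fun k => hw' _ (hpos k)
  have hlaw := fun k => hlaw' _ (hpos k)
  have hsing := fun k => hsing' _ (hpos k)
  set t : ℕ → ℝ := fun k => t' _ (hpos k) with ht_def
  have ht : ∀ k, t k < 0 := fun k => ht' _ (hpos k)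
  have hq := fun k => hq' _ (hpos k)
  set c : ℕ → ℝ := fun k => Real.sqrt (-t k) with hc_def
  have hc : ∀ k, 0 < c k := fun k => Real.sqrt_pos.2 (neg_pos.2 (ht k))
  set v : ℕ → ℝ → EuclideanSpace ℝ (Fin 3) → EuclideanSpace ℝ (Fin 3) :=
    fun k => nsRescale (c k) (w k) with hv_def
  have hv : ∀ k, IsTypeIAncientMild C (v k) := fun k => isTypeIAncientMild_nsRescale (hw k) (hc k)
  have hvlaw : ∀ k, ∀ s : ℝ, s < 0 →
      ∫⁻ x, ‖fderiv ℝ (v k s) x‖ₑ ^ 2 ≤ ENNReal.ofReal (K / Real.sqrt (-s)) :=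
    fun k => RecurrentReductionD.dissipationLaw_nsRescale (hlaw k) (hc k)
  have hvsing : ∀ k, ∀ ρ > 0, ∀ M : ℝ, ∃ t ∈ Ioo (-(ρ ^ 2)) (0 : ℝ),
      ∃ x ∈ ball (0 : EuclideanSpace ℝ (Fin 3)) ρ, M < ‖v k t x‖ :=
    fun k => RecurrentReductionD.singularAtOrigin_nsRescale (hsing k) (hc k)
  have hvclose : ∀ k, ∀ ψ : EuclideanSpace ℝ (Fin 3) → EuclideanSpace ℝ (Fin 3),
      FunctionSpaces.IsTestFunctionOn (⊤ : Opens (EuclideanSpace ℝ (Fin 3))) ψ →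
      ∀ T : ℝ, Tendsto (fun s => ∫ x, ⟪v k s x, ψ x⟫) (𝓝[<] 0) (𝓝 T) →
        |T - ∫ x, ⟪v k (-1) x, ψ x⟫| ≤ 1 / ((k : ℝ) + 1) * Real.sqrt (∫ x, ‖ψ x‖ ^ 2) :=
    fun k => pairing_sub_trace_nsRescale (hw k) (hlaw k) (ht k) (hq k)
  exact false_of_earlyArrival_seq hv hvlaw hvsing hvclose

/-- **NO-EARLY-ARRIVAL FLOOR** (portrait clause): for all `C, K` there is `δ > 0` such that every
SINGULAR member of `𝒟_{C,K}` has, at EVERY instant `t < 0`, a test field `ψ` with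
`|T_w(ψ) − ∫⟪w(t), ψ⟫| > δ (−t)^{1/4} ‖ψ‖_{L²}`: the slice is never `δ`-close to the final datum.
[cite: KochNadirashviliSereginSverak2009, §4 (arXiv:0709.3599 p. 8)] -/
theorem remainder_floor_of_singular : ∀ (C K : ℝ), ∃ δ > 0,
    ∀ (w : ℝ → EuclideanSpace ℝ (Fin 3) → EuclideanSpace ℝ (Fin 3)),
      IsTypeIAncientMild C w →
      (∀ s : ℝ, s < 0 → ∫⁻ x, ‖fderiv ℝ (w s) x‖ₑ ^ 2 ≤ ENNReal.ofReal (K / Real.sqrt (-s))) →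
      (∀ ρ > 0, ∀ M : ℝ, ∃ t ∈ Ioo (-(ρ ^ 2)) (0 : ℝ),
        ∃ x ∈ ball (0 : EuclideanSpace ℝ (Fin 3)) ρ, M < ‖w t x‖) →
      ∀ t < 0, ∃ (ψ : EuclideanSpace ℝ (Fin 3) → EuclideanSpace ℝ (Fin 3)) (T : ℝ),
        FunctionSpaces.IsTestFunctionOn (⊤ : Opens (EuclideanSpace ℝ (Fin 3))) ψ ∧
        Tendsto (fun s => ∫ x, ⟪w s x, ψ x⟫) (𝓝[<] 0) (𝓝 T) ∧
        δ * (-t) ^ (1 / 4 : ℝ) * Real.sqrt (∫ x, ‖ψ x‖ ^ 2) < |T - ∫ x, ⟪w t x, ψ x⟫| := by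
  intro C K
  obtain ⟨δ, hδ, h⟩ := earlyArrival_leaf C K
  refine ⟨δ, hδ, fun w hw hlaw hsing t ht => ?_⟩
  by_contra hcon
  push Not at hcon
  exact h w hw hlaw ⟨t, ht, fun ψ hψ T hT => hcon ψ T hψ hT⟩ hsing

/-- **TWO-SIDED LAW FOR THE ENERGY OF THE SINGULAR PART — the floor.** If `W ∈ 𝒟_{C,K}` is
SINGULAR and `u₀` is a measurable field which is its trace for every test field with
`∫ ‖W(t) − u₀‖² < ∞` (as supplied for the critical element by `…EnergyTraceDatum` /
`…EnergyRemainder`), then `δ(C,K)² √(−t) < ∫ ‖W(t) − u₀‖²` for every `t < 0`. Together with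
`EnergyRemainder.lintegral_sub_finalDatum_sq_le`: `δ² √(−t) < ‖W(t) − u₀‖²_{L²} ≤ M √(−t)`. -/
theorem remainderEnergy_floor (C K : ℝ) : ∃ δ > 0,
    ∀ (W : ℝ → EuclideanSpace ℝ (Fin 3) → EuclideanSpace ℝ (Fin 3)),
      IsTypeIAncientMild C W →
      (∀ s : ℝ, s < 0 → ∫⁻ x, ‖fderiv ℝ (W s) x‖ₑ ^ 2 ≤ ENNReal.ofReal (K / Real.sqrt (-s))) →
      (∀ ρ > 0, ∀ M : ℝ, ∃ t ∈ Ioo (-(ρ ^ 2)) (0 : ℝ),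
        ∃ x ∈ ball (0 : EuclideanSpace ℝ (Fin 3)) ρ, M < ‖W t x‖) →
      ∀ (u₀ : EuclideanSpace ℝ (Fin 3) → EuclideanSpace ℝ (Fin 3)),
        AEStronglyMeasurable u₀ (volume : Measure (EuclideanSpace ℝ (Fin 3))) →
        (∀ ψ : EuclideanSpace ℝ (Fin 3) → EuclideanSpace ℝ (Fin 3),
          FunctionSpaces.IsTestFunctionOn (⊤ : Opens (EuclideanSpace ℝ (Fin 3))) ψ →
          Tendsto (fun s => ∫ x, ⟪W s x, ψ x⟫) (𝓝[<] 0) (𝓝 (∫ x, ⟪u₀ x, ψ x⟫))) →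
        ∀ t < 0, ∫⁻ x, ‖W t x - u₀ x‖ₑ ^ 2 ≠ ⊤ →
          ENNReal.ofReal (δ ^ 2 * Real.sqrt (-t)) < ∫⁻ x, ‖W t x - u₀ x‖ₑ ^ 2 := by
  obtain ⟨δ, hδ, hfloor⟩ := remainder_floor_of_singular C K
  refine ⟨δ, hδ, fun W hW hlaw hsing u₀ hu₀m htrace t ht hfin => ?_⟩
  obtain ⟨ψ, T, hψ, hT, hlt⟩ := hfloor W hW hlaw hsing t ht
  have hTeq : T = ∫ x, ⟪u₀ x, ψ x⟫ := tendsto_nhds_unique hT (htrace ψ hψ)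
  -- Cauchy–Schwarz for the remainder `u₀ − W(t)`
  set E : ℝ := (∫⁻ x, ‖W t x - u₀ x‖ₑ ^ 2).toReal with hE
  have hE0 : 0 ≤ E := ENNReal.toReal_nonneg
  have hmeas : AEStronglyMeasurable (fun x => u₀ x - W t x) (volume : Measure (EuclideanSpace ℝ (Fin 3))) :=
    hu₀m.sub (hW.continuous_slice ht).aestronglyMeasurable
  have hEle : ∫⁻ x, ‖u₀ x - W t x‖ₑ ^ 2 ≤ ENNReal.ofReal E := by
    have e : (fun x => ‖u₀ x - W t x‖ₑ ^ 2) = fun x => ‖W t x - u₀ x‖ₑ ^ 2 := by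
      funext x; rw [← enorm_neg, neg_sub]
    rw [e, hE, ENNReal.ofReal_toReal hfin]
  obtain ⟨hintd, hbd⟩ := EnergyTrace.abs_integral_inner_le_of_lintegral_sq_le hmeas hE0 hEle hψ
  -- `T − ∫⟪W t, ψ⟫ = ∫⟪u₀ − W t, ψ⟫`
  have hcψ : Continuous ψ := hψ.contDiff.continuous
  have hintW : Integrable (fun x => ⟪W t x, ψ x⟫) :=
    integrable_inner_of_continuous_of_hasCompactSupport (hW.continuous_slice ht) hcψ hψ.hasCompactSupport
  have hintu : Integrable (fun x => ⟪u₀ x, ψ x⟫) := by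
    have e : (fun x => ⟪u₀ x, ψ x⟫) = fun x => ⟪u₀ x - W t x, ψ x⟫ + ⟪W t x, ψ x⟫ := by
      funext x; rw [inner_sub_left]; ring
    rw [e]; exact hintd.add hintW
  have hsub : T - ∫ x, ⟪W t x, ψ x⟫ = ∫ x, ⟪u₀ x - W t x, ψ x⟫ := by
    rw [hTeq, ← integral_sub hintu hintW]
    refine integral_congr_ae (ae_of_all _ fun x => ?_)
    simp only [inner_sub_left]
  rw [hsub] at hlt
  set I : ℝ := Real.sqrt (∫ x, ‖ψ x‖ ^ 2) with hI
  have hI0 : 0 ≤ I := Real.sqrt_nonneg _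
  have hchain : δ * (-t) ^ (1 / 4 : ℝ) * I < Real.sqrt E * I := lt_of_lt_of_le hlt hbd
  have hkey : δ * (-t) ^ (1 / 4 : ℝ) < Real.sqrt E := lt_of_mul_lt_mul_right hchain hI0
  have hq0 : 0 ≤ (-t) ^ (1 / 4 : ℝ) := Real.rpow_nonneg (neg_nonneg.2 ht.le) _
  have hsq : δ ^ 2 * Real.sqrt (-t) < E := by
    have h1 : 0 ≤ δ * (-t) ^ (1 / 4 : ℝ) := by positivity
    have h2 := mul_self_lt_mul_self h1 hkey
    rw [Real.mul_self_sqrt hE0] at h2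
    have hqq : (-t) ^ (1 / 4 : ℝ) * (-t) ^ (1 / 4 : ℝ) = Real.sqrt (-t) := by
      rw [← Real.rpow_add_of_nonneg (neg_nonneg.2 ht.le) (by norm_num) (by norm_num),
        Real.sqrt_eq_rpow]
      norm_num
    calc δ ^ 2 * Real.sqrt (-t) = δ * (-t) ^ (1 / 4 : ℝ) * (δ * (-t) ^ (1 / 4 : ℝ)) := by
          rw [mul_mul_mul_comm, hqq]; ring
      _ < E := h2
  rw [← ENNReal.ofReal_toReal hfin, ← hE]
  exact (ENNReal.ofReal_lt_ofReal_iff (lt_of_le_of_lt (by positivity) hsq)).2 hsq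

end Summit.NavierStokesRegularity.NavierStokesRegularity.Theorems.FiniteDissipationLiouville.EnergyReturn

end
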